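/-
Copyright: the b2b-balaban T⁴-continuum CRUX team, row NE7b OWNER lineage `t4-ne7b-p1` (gen 140). Project licence.
-/
import Summits.QuantumFields.BalabanUV.T4Continuum.Spine.NE7b.SupWhitenedCovarianceKernelLetter
import Summits.QuantumFields.BalabanUV.T4Continuum.Spine.NE7b.SupBlockHessianKernelLetter

/-!
# THE WHITENED MOMENT LETTERS DISCHARGED (SCOPING (d11)(3), third file): (457)'s two hypotheses in `ξ`-coordinates,
#   `e^{−U(Aξ+ψ)} ∈ L¹(N(0,I_κ))`   and   `e^{−U(Aξ+ψ)}·ξ_w² ∈ L¹(N(0,I_κ))`,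
# follow from the block class's STABILITY `−κ₀Σ_Yφ² ≤ U(φ)` and the operator letter of the factor, `|Aξ|² ≤ γ_op|ξ|²` — which IS the
# road's `(γ_op·1 − Γ) ⪰ 0` for `Γ = AAᵀ` (`‖A‖ = ‖Aᵀ‖`): the first by the pushforward from the road's own (401) `integrable_exp_neg_block`
# (regulator `2κ₀(1+τ)γ_op ≤ θ < 1`), the second directly under `N(0,I)` with the WHITENED REGULATOR `2κ₀(1+τ)γ_op + 4δ ≤ θ < 1` (the `4δ`
# room now sits in `ξ`-units, where the covariance is `I`).  Assembled: (457)'s covariance kernel letter for the block class with NO moment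
# hypothesis and NO precision condition — stability, the two regulators, the Hessian majorant's letters and the factor's letters only
# (row NE7b, node U5c; (457), (401)∕`SupBlockEffectiveActionDerivative`, `SupGaussianRegulator`, `Literature.…GaussianLinearCompensation` BY
# NAME; [folklore])

Cell `pub-balaban`, sub-cell `t4`, spine estimate NE7b (`T4WeightBudget.RelWeightBound`; the cell's OWN estimate — NOT PRINTED in
[Bałaban 1983–89], NOT PROVED).  Crux-route work under `Spine/NE7b/` by the row OWNER (`t4-ne7b-p1` gen 140, file (458)) under FREEZE
(0)'s crux-prover clause; NOTHING of Bałaban's is named as a Lean object, valued or asserted; no `T4Continuum/Support` leaf typed; no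
`def`, no notation; zero `sorry`.  Imports (BY NAME): the OWNER's (457) `…SupWhitenedCovarianceKernelLetter` (`whitened_integrable_iff`,
`whitened_cov_kernel_rowsum_le`), `SupBlockEffectiveActionDerivative` (`neg_block_le`, `integrable_exp_neg_block`), `SupGaussianRegulator`
(`integrable_exp_half_weighted_sq`), `SupBlockHessianKernelLetter` (`sq_le_exp_div`), `Literature.Probability.Distributions.
GaussianLinearCompensation` (`dotProduct_transpose_mulVec_le_of`, `ofLp_matrixCLM`).

WHAT IS PROVED ([folklore]; `A : Matrix ι κ ℝ`, `T = matrixCLM A`):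
* §1 the factor's letters: `posSemidef_AAT` (`AAᵀ ⪰ 0`), `transpose_op_letter` (`(γ_op·1 − AAᵀ) ⪰ 0 ⟹ |Aᵀy|² ≤ γ_op|y|²`), **`whitened_op_letter`**
  (`⟹ |Aξ|² ≤ γ_op|ξ|²`), `whitened_sq_sum_le` (`Σ_{x∈Y}(Tξ)_x² ≤ γ_op Σ_w ξ_w²`).
* §2 **`whitened_exp_integrable`** (`e^{−U(Tξ+ψ)} ∈ L¹(N(0,I))` by pushforward of (401)), **`whitened_second_moment_integrable`**
  (`e^{−U(Tξ+ψ)}ξ_w² ∈ L¹(N(0,I))` under the whitened regulator).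
* §3 THE ASSEMBLY **`whitened_class_cov_kernel_rowsum_le`**: (457)'s END with the moment letters discharged.

HONEST (what this is NOT).  The whitened regulator `2κ₀(1+τ)γ_op + 4δ ≤ θ` differs from the road's `(2κ₀(1+τ) + 4δ)γ_op ≤ θ` only in
where the `δ`-room is measured (both are letters; `δ > 0` is free); the output Hessian letters in the whitened dress are (459); third-order
kernel letters ((d11)(4)) NOT touched.  Scalar skeleton ((A3), NC-NE7b-α UNRULED); nothing of Bałaban's asserted.  BY-NAME EFFECT ON THE
WALL: NONE.  NE7b NOT PRINTED ∕ NOT PROVED; spine PROVED 0∕9; rung (B)+1 — the programme's measures remain FINITE-torus statements; NOT the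
mass gap, NOT Clay.  HONEST DEPENDENCY: continuum YM on T⁴ ⇐ BetaPertH ∧ nine spine estimates (0∕9 proved); BetaPertH ⇐ (D1) ∧ (D4) ∧
CAP+tail; G-an2-4 gates asym, D1 and NE2∕3∕4.
-/

set_option autoImplicit false

noncomputable section

namespace Summit.QuantumFields.BalabanUV.T4Continuum.NE7b.SupWhitenedMomentLetters

open MeasureTheory ProbabilityTheory Real Set Function Finset Matrix
open scoped BigOperators
open Literature.Probability.Distributions (matrixCLM ofLp_matrixCLM dotProduct_transpose_mulVec_le_of)
open SupWhitenedCovarianceKernelLetter (whitened_integrable_iff whitened_cov_kernel_rowsum_le)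
open SupBlockEffectiveActionDerivative (neg_block_le integrable_exp_neg_block)
open SupGaussianRegulator (integrable_exp_half_weighted_sq)
open SupBlockHessianKernelLetter (sq_le_exp_div)

variable {ι κ : Type} [Fintype ι] [DecidableEq ι] [Fintype κ] [DecidableEq κ]

variable {U : EuclideanSpace ℝ ι → ℝ} {U' : EuclideanSpace ℝ ι → EuclideanSpace ℝ ι →L[ℝ] ℝ}
  {U'' : EuclideanSpace ℝ ι → EuclideanSpace ℝ ι →L[ℝ] EuclideanSpace ℝ ι →L[ℝ] ℝ} {Hk : ι → ι → ℝ} {A : Matrix ι κ ℝ}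
  {ψ : EuclideanSpace ℝ ι} {αr αc hr hc lamA γ γ' γop κ₀ τ δ θ : ℝ}

/-! ## §1. The factor's letters -/

omit [DecidableEq ι] [DecidableEq κ] in
/-- **`AAᵀ ⪰ 0`**. [folklore] -/
theorem posSemidef_AAT (A : Matrix ι κ ℝ) : (A * Aᵀ).PosSemidef := by
  simpa only [conjTranspose_eq_transpose_of_trivial] using Matrix.posSemidef_self_mul_conjTranspose A

omit [DecidableEq κ] in
/-- **The road's operator letter read on the factor**: `(γ_op·1 − AAᵀ) ⪰ 0 ⟹ |Aᵀy|² ≤ γ_op|y|²` for all `y`. [folklore] -/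
theorem transpose_op_letter (hΓop : (γop • (1 : Matrix ι ι ℝ) - A * Aᵀ).PosSemidef) (y : ι → ℝ) :
    (Aᵀ *ᵥ y) ⬝ᵥ (Aᵀ *ᵥ y) ≤ γop * (y ⬝ᵥ y) := by
  have h := hΓop.dotProduct_mulVec_nonneg y
  rw [star_trivial, sub_mulVec, dotProduct_sub, smul_mulVec, one_mulVec, dotProduct_smul, smul_eq_mul, ← mulVec_mulVec, dotProduct_mulVec,
    ← mulVec_transpose] at h
  linarith

omit [DecidableEq κ] in
/-- `γ_op ≥ 0` from the operator letter (`ι` inhabited). [folklore] -/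
theorem op_letter_nonneg [Nonempty ι] (hΓop : (γop • (1 : Matrix ι ι ℝ) - A * Aᵀ).PosSemidef) : 0 ≤ γop := by
  obtain ⟨u₀⟩ := ‹Nonempty ι›
  have h := transpose_op_letter hΓop (Pi.single u₀ (1 : ℝ))
  have h1 : (Pi.single u₀ (1 : ℝ) : ι → ℝ) ⬝ᵥ Pi.single u₀ (1 : ℝ) = 1 := by simp
  rw [h1, mul_one] at h
  exact le_trans (by simp only [dotProduct]; exact Finset.sum_nonneg fun i _ => mul_self_nonneg _) h

omit [DecidableEq κ] in
/-- **THE WHITENED OPERATOR LETTER**: `(γ_op·1 − AAᵀ) ⪰ 0 ⟹ |Aξ|² ≤ γ_op|ξ|²` (`‖A‖ = ‖Aᵀ‖`: `Literature.….dotProduct_transpose_mulVec_le_of`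
BY NAME). [folklore] -/
theorem whitened_op_letter [Nonempty ι] (hΓop : (γop • (1 : Matrix ι ι ℝ) - A * Aᵀ).PosSemidef) (ξ : κ → ℝ) :
    (A *ᵥ ξ) ⬝ᵥ (A *ᵥ ξ) ≤ γop * (ξ ⬝ᵥ ξ) := by
  have hγ := op_letter_nonneg hΓop
  have hU : ∀ y : ι → ℝ, (Aᵀ *ᵥ y) ⬝ᵥ (Aᵀ *ᵥ y) ≤ Real.sqrt γop ^ 2 * (y ⬝ᵥ y) := fun y => by
    rw [Real.sq_sqrt hγ]; exact transpose_op_letter hΓop y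
  have h := dotProduct_transpose_mulVec_le_of Aᵀ hU ξ
  rw [transpose_transpose, Real.sq_sqrt hγ] at h
  exact h

/-- **`Σ_{x∈Y}(Tξ)_x² ≤ γ_op·Σ_w ξ_w²`** for `T = matrixCLM A`. [folklore] -/
theorem whitened_sq_sum_le [Nonempty ι] (hΓop : (γop • (1 : Matrix ι ι ℝ) - A * Aᵀ).PosSemidef) (Y : Finset ι) (ξ : EuclideanSpace ℝ κ) :
    ∑ x ∈ Y, matrixCLM A ξ x ^ 2 ≤ γop * ∑ w, ξ w ^ 2 := by
  have h := whitened_op_letter hΓop (WithLp.ofLp ξ)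
  have e1 : (A *ᵥ WithLp.ofLp ξ) ⬝ᵥ (A *ᵥ WithLp.ofLp ξ) = ∑ x, matrixCLM A ξ x ^ 2 := by
    have e : ∀ x, matrixCLM A ξ x = (A *ᵥ WithLp.ofLp ξ) x := fun x => by rw [← ofLp_matrixCLM]
    simp only [dotProduct, e, sq]
  have e2 : WithLp.ofLp ξ ⬝ᵥ WithLp.ofLp ξ = ∑ w, ξ w ^ 2 := by
    simp only [dotProduct, sq]
  rw [e1, e2] at h
  exact le_trans (Finset.sum_le_univ_sum_of_nonneg fun x => sq_nonneg _) h

/-! ## §2. The two moment letters in `ξ`-coordinates -/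

/-- **`e^{−U(Tξ+ψ)} ∈ L¹(N(0,I_κ))`** from stability and the road's regulator `2κ₀(1+τ)γ_op ≤ θ < 1`, by the pushforward of (401)
`integrable_exp_neg_block` for `Γ = AAᵀ`. [folklore] -/
theorem whitened_exp_integrable (hΓop : (γop • (1 : Matrix ι ι ℝ) - A * Aᵀ).PosSemidef) (Y : Finset ι) (hUm : Measurable U) (hκ₀ : 0 ≤ κ₀)
    (hτ : 0 < τ) (hθ1 : θ < 1) (hκθ : 2 * κ₀ * (1 + τ) * γop ≤ θ) (hstab : ∀ φ : EuclideanSpace ℝ ι, -(κ₀ * ∑ x ∈ Y, φ x ^ 2) ≤ U φ)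
    (ψ : EuclideanSpace ℝ ι) :
    Integrable (fun ξ : EuclideanSpace ℝ κ => exp (-U (matrixCLM A ξ + ψ))) (multivariateGaussian 0 (1 : Matrix κ κ ℝ)) := by
  have hmeas : Measurable fun ω : EuclideanSpace ℝ ι => exp (-U (ω + ψ)) := measurable_exp.comp (hUm.comp (measurable_id.add_const ψ)).neg
  exact (whitened_integrable_iff A hmeas.aestronglyMeasurable).1
    (integrable_exp_neg_block (posSemidef_AAT A) hΓop Y hUm hκ₀ hτ hθ1 hκθ hstab ψ)

/-- **`e^{−U(Tξ+ψ)}·ξ_w² ∈ L¹(N(0,I_κ))`** from stability, the operator letter and the WHITENED regulator `2κ₀(1+τ)γ_op + 4δ ≤ θ < 1`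
(the weight `4δ` at `w` absorbs `ξ_w²`; `|T_Yξ|² ≤ γ_op|ξ|²` makes the Gaussian weight diagonal). [folklore] -/
theorem whitened_second_moment_integrable [Nonempty ι] (hΓop : (γop • (1 : Matrix ι ι ℝ) - A * Aᵀ).PosSemidef) (Y : Finset ι)
    (hUm : Measurable U) (hκ₀ : 0 ≤ κ₀) (hτ : 0 < τ) (hδ : 0 < δ) (hθ1 : θ < 1) (hκθw : 2 * κ₀ * (1 + τ) * γop + 4 * δ ≤ θ)
    (hstab : ∀ φ : EuclideanSpace ℝ ι, -(κ₀ * ∑ x ∈ Y, φ x ^ 2) ≤ U φ) (ψ : EuclideanSpace ℝ ι) (w : κ) :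
    Integrable (fun ξ : EuclideanSpace ℝ κ => exp (-U (matrixCLM A ξ + ψ)) * ξ w ^ 2) (multivariateGaussian 0 (1 : Matrix κ κ ℝ)) := by
  have hγ := op_letter_nonneg hΓop
  -- the diagonal weights `2κ₀(1+τ)γ_op + 4δ·1_{w}` under `N(0, I)` (operator letter `1`)
  set wt : κ → ℝ := fun i => 2 * κ₀ * (1 + τ) * γop + (if i = w then 4 * δ else 0) with hwt
  have hk0 : 0 ≤ 2 * κ₀ * (1 + τ) * γop := by positivity
  have hwt0 : ∀ i, 0 ≤ wt i := fun i => by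
    simp only [hwt]; split_ifs <;> linarith
  have hwtκ : ∀ i, wt i ≤ 2 * κ₀ * (1 + τ) * γop + 4 * δ := fun i => by
    simp only [hwt]; split_ifs <;> linarith
  have hI : ((1 : ℝ) • (1 : Matrix κ κ ℝ) - 1).PosSemidef := by rw [one_smul, sub_self]; exact Matrix.PosSemidef.zero
  have hint := (integrable_exp_half_weighted_sq Matrix.PosSemidef.one hI wt hwt0 hwtκ (by positivity) hθ1 (by rw [mul_one]; exact hκθw)).const_mul
    (exp (κ₀ * (1 + τ⁻¹) * ∑ x ∈ Y, ψ x ^ 2) / (2 * δ))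
  have hmeas : Measurable fun ξ : EuclideanSpace ℝ κ => exp (-U (matrixCLM A ξ + ψ)) * ξ w ^ 2 :=
    (measurable_exp.comp (hUm.comp ((matrixCLM A).continuous.measurable.add_const ψ)).neg).mul
      ((by fun_prop : Continuous fun ξ : EuclideanSpace ℝ κ => ξ w).measurable.pow_const 2)
  refine hint.mono' hmeas.aestronglyMeasurable (ae_of_all _ fun ξ => ?_)
  rw [Real.norm_of_nonneg (mul_nonneg (exp_pos _).le (sq_nonneg _))]
  have h1 := neg_block_le Y hκ₀ hτ hstab (matrixCLM A ξ) ψ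
  have h2 := sq_le_exp_div hδ (ξ w ^ 2)
  have h3 : κ₀ * (1 + τ) * ∑ x ∈ Y, matrixCLM A ξ x ^ 2 ≤ κ₀ * (1 + τ) * (γop * ∑ i, ξ i ^ 2) :=
    mul_le_mul_of_nonneg_left (whitened_sq_sum_le hΓop Y ξ) (by positivity)
  have hsum : κ₀ * (1 + τ) * (γop * ∑ i, ξ i ^ 2) + 2 * δ * ξ w ^ 2 = (∑ i, wt i * ξ i ^ 2) / 2 := by
    simp only [hwt, add_mul, Finset.sum_add_distrib, ite_mul, zero_mul]
    rw [Finset.sum_ite_eq' Finset.univ w, if_pos (Finset.mem_univ w), ← Finset.mul_sum]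
    ring
  calc exp (-U (matrixCLM A ξ + ψ)) * ξ w ^ 2
      ≤ exp (κ₀ * (1 + τ) * (γop * ∑ i, ξ i ^ 2) + κ₀ * (1 + τ⁻¹) * ∑ x ∈ Y, ψ x ^ 2) * (exp (2 * δ * ξ w ^ 2) / (2 * δ)) :=
        mul_le_mul (exp_le_exp.2 (by linarith)) h2 (sq_nonneg _) (exp_pos _).le
    _ = exp (κ₀ * (1 + τ⁻¹) * ∑ x ∈ Y, ψ x ^ 2) / (2 * δ) * exp ((∑ i, wt i * ξ i ^ 2) / 2) := by
        rw [← hsum, exp_add, exp_add]; field_simp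
    _ = exp (κ₀ * (1 + τ⁻¹) * ∑ x ∈ Y, ψ x ^ 2) / (2 * δ) * exp ((∑ i, wt i * ξ i ^ 2) / 2) := rfl

/-! ## §3. The assembly: (457) with the moment letters discharged -/

/-- **THE COVARIANCE KERNEL LETTER OF THE BLOCK CLASS UNDER `N(0, AAᵀ)` — NO PRECISION CONDITION, NO MOMENT HYPOTHESIS**: the block
class's stability `−κ₀Σ_Yφ² ≤ U`, `U ∈ C²` with an entrywise Hessian majorant `Hk ≥ 0` (rows `≤ hr`, columns `≤ hc`), the road's operator letter
`(γ_op·1 − AAᵀ) ⪰ 0`, the regulators `2κ₀(1+τ)γ_op ≤ θ`, `2κ₀(1+τ)γ_op + 4δ ≤ θ < 1`, the factor's `ℓ¹` letters `αr, αc`, the diagonal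
letter `lamA < 1` and the smallness `αc·hr·αr ≤ γ(1−lamA)`, `αc·hc·αr ≤ γ′(1−lamA)` (`γ, γ′ < 1`) give, for every `ψ` and `x`,
`Σ_y |C_{xy}(ψ)| ≤ (hr·αr)·(αc·hc)·(1−γ)⁻¹(1−γ′)⁻¹∕(1−lamA)`. [folklore: Dobrushin 1970, Föllmer 1982] -/
theorem whitened_class_cov_kernel_rowsum_le [Nonempty κ] (hΓop : (γop • (1 : Matrix ι ι ℝ) - A * Aᵀ).PosSemidef) (Y : Finset ι)
    (hUd : ∀ φ : EuclideanSpace ℝ ι, HasFDerivAt U (U' φ) φ) (hU'd : ∀ φ : EuclideanSpace ℝ ι, HasFDerivAt U' (U'' φ) φ)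
    (hHk : ∀ (φ : EuclideanSpace ℝ ι) (x z : ι), |U'' φ (EuclideanSpace.single z (1 : ℝ)) (EuclideanSpace.single x (1 : ℝ))| ≤ Hk x z)
    (hHk0 : ∀ v u, 0 ≤ Hk v u) (hκ₀ : 0 ≤ κ₀) (hτ : 0 < τ) (hδ : 0 < δ) (hθ1 : θ < 1) (hκθ : 2 * κ₀ * (1 + τ) * γop ≤ θ)
    (hκθw : 2 * κ₀ * (1 + τ) * γop + 4 * δ ≤ θ) (hstab : ∀ φ : EuclideanSpace ℝ ι, -(κ₀ * ∑ x ∈ Y, φ x ^ 2) ≤ U φ) (ψ : EuclideanSpace ℝ ι)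
    (hαr : ∀ u, ∑ w, |A u w| ≤ αr) (hαc : ∀ w, ∑ u, |A u w| ≤ αc) (hhr : ∀ v, ∑ u, Hk v u ≤ hr) (hhc : ∀ u, ∑ v, Hk v u ≤ hc)
    (hlam : ∀ x : κ, ∑ u, ∑ v, |A u x| * |A v x| * Hk v u ≤ lamA) (hlam1 : lamA < 1)
    (hγ : αc * hr * αr / (1 - lamA) ≤ γ) (hγ1 : γ < 1) (hγ' : αc * hc * αr / (1 - lamA) ≤ γ') (hγ'1 : γ' < 1) (x : ι) :
    ∑ y, |((∫ ω : EuclideanSpace ℝ ι, exp (-U (ω + ψ)) ∂(multivariateGaussian 0 (A * Aᵀ)))⁻¹ * (∫ ω : EuclideanSpace ℝ ι, exp (-U (ω + ψ)) * (U' (ω + ψ)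
          (EuclideanSpace.single x (1 : ℝ)) * U' (ω + ψ) (EuclideanSpace.single y (1 : ℝ))) ∂(multivariateGaussian 0 (A * Aᵀ))) - ((∫ ω : EuclideanSpace ℝ ι, exp (-U (ω + ψ))
          ∂(multivariateGaussian 0 (A * Aᵀ))) ^ 2)⁻¹ * ((∫ ω : EuclideanSpace ℝ ι, exp (-U (ω + ψ)) * U' (ω + ψ) (EuclideanSpace.single x (1 : ℝ)) ∂(multivariateGaussian 0 (A * Aᵀ))) *
          (∫ ω : EuclideanSpace ℝ ι, exp (-U (ω + ψ)) * U' (ω + ψ) (EuclideanSpace.single y (1 : ℝ)) ∂(multivariateGaussian 0 (A * Aᵀ)))))| ≤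
      hr * αr * (αc * hc) * (1 - γ)⁻¹ * (1 - γ')⁻¹ / (1 - lamA) := by
  haveI : Nonempty ι := ⟨x⟩
  have hUm : Measurable U := (continuous_iff_continuousAt.2 fun φ => (hUd φ).continuousAt).measurable
  exact whitened_cov_kernel_rowsum_le hUd hU'd hHk hHk0 A ψ hαr hαc hhr hhc hlam hlam1 hγ hγ1 hγ' hγ'1
    (whitened_exp_integrable hΓop Y hUm hκ₀ hτ hθ1 hκθ hstab ψ)
    (fun w => whitened_second_moment_integrable hΓop Y hUm hκ₀ hτ hδ hθ1 hκθw hstab ψ w) x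

end Summit.QuantumFields.BalabanUV.T4Continuum.NE7b.SupWhitenedMomentLetters

end
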